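import Mathlib
import HarnessLib
import Summits.ResolutionOfSingularities.ResolutionOfSingularities.Theorems.WildQuotientsWildQuotientResolutionS1aLogExitFramesExit

/-!
# Line L exit — (F1) proof part A (= old part 3 re-based): graded invariants of a graded automorphism

[OURS · L1 W4.5c · idea-1 g11; plan-1 RULING (F1)/(γ′) SHAPE v1 2026-08-27T20:12:52Z; memos
`L/res-L1-w45c-idea-1/f1/F1-SHAPE.md` … `F1-SHAPE-v4.md`] — NOT statements of the manuscript; counted 0;
AI-written and AI-reviewed only (weaker than expert review). Crux stmt-ResolutionOfSingularities-17941
(`WildQuotients.CyclicQuotientFourfolds`), skeleton line `s1a-logminvertex`, stubs `stub_localGame` (EXIT half: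
the `S1.LogExitZone` clause of `S1.KillOrExitModel`) / `stub_logExitPatching`. RE-BASED on the landed v2.1 split
(lead-1 g6: p572524 `…S1aLogExitFrames` §1–§4, p572600 `…S1aLogExitFramesCone` §5, p573485 `…S1aLogExitFramesExit` §6):
this file is §7 of the single-file module v3.1 (`f1/S1aLogExitFrames.lean` sha16 5df58ac680c11dc2), declarations
byte-identical, same namespace `…Theorems.WildQuotientResolution.S1.LogExitFrames`. No `sorry`, no `instance`, no
`notation`; Literature notions (`augmentationIdeal`, `invariantSubring`, `LogChart.*`) are CITED, not restated.

* §7 (REAL): graded invariants of a GRADED automorphism — `coe_decompose_map_of_graded` (σ commutes with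
  `DirectSum.decompose`), `coe_decompose_mem_invariantSubring` (`B^σ` is a graded subring), units / locality /
  maximal ideals of `B^σ` and of `degZeroInvariants`, and `coe_decompose_mem_maximalIdeal` ((R-triv) ⇒ the
  homogeneous components of an element of `𝔪_B` lie in `𝔪_B`).
-/

set_option linter.dupNamespace false

noncomputable section

open CategoryTheory AlgebraicGeometry TopologicalSpace
open Literature.AlgebraicGeometry.Resolution

namespace Summit.ResolutionOfSingularities.ResolutionOfSingularities.Theorems.WildQuotientResolution.S1.LogExitFrames

/-! ## §7 Toward `F1Loc`: graded invariants of a graded automorphism (REAL lemmas, v3) -/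

section GradedInvariants

open DirectSum

variable {ι : Type*} [DecidableEq ι] [AddCommGroup ι] {B : Type*} [CommRing B]
  (𝒜 : ι → AddSubgroup B) [GradedRing 𝒜] (σ : B ≃+* B)

/-- A GRADED ring automorphism commutes with taking homogeneous components. [OURS · L1 W4.5c] -/
theorem coe_decompose_map_of_graded (hσ : ∀ c : ι, ∀ b ∈ 𝒜 c, σ b ∈ 𝒜 c) (b : B) (c : ι) :
    ((decompose 𝒜 (σ b)) c : B) = σ ((decompose 𝒜 b) c) := by
  induction b using DirectSum.Decomposition.inductionOn 𝒜 with
  | zero => simp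
  | @homogeneous i m =>
    by_cases hic : i = c
    · subst hic
      rw [decompose_of_mem_same 𝒜 (hσ i _ m.2), decompose_of_mem_same 𝒜 m.2]
    · rw [decompose_of_mem_ne 𝒜 (hσ i _ m.2) hic, decompose_of_mem_ne 𝒜 m.2 hic, map_zero]
  | add a a' ha ha' =>
    rw [map_add, decompose_add, decompose_add, DirectSum.add_apply, DirectSum.add_apply,
      AddMemClass.coe_add, AddMemClass.coe_add, map_add, ha, ha']

/-- Components of a `σ`-invariant element are `σ`-invariant (for `σ` graded): the invariant subring
`B^σ` is a graded subring. [OURS · L1 W4.5c] -/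
theorem coe_decompose_mem_invariantSubring (hσ : ∀ c : ι, ∀ b ∈ 𝒜 c, σ b ∈ 𝒜 c) {b : B}
    (hb : b ∈ invariantSubring σ) (c : ι) : ((decompose 𝒜 b) c : B) ∈ invariantSubring σ := by
  rw [mem_invariantSubring_iff] at hb ⊢
  rw [← coe_decompose_map_of_graded 𝒜 σ hσ b c, hb]

omit [DecidableEq ι] [GradedRing 𝒜] in
/-- The inverse of an invariant unit is invariant. [folklore] -/
theorem map_eq_self_of_mul_eq_one {x w : B} (hx : σ x = x) (hw : x * w = 1) : σ w = w := by
  have h2 : x * σ w = 1 := by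
    have := congr_arg σ hw
    rwa [map_mul, map_one, hx] at this
  calc σ w = (w * x) * σ w := by rw [mul_comm w, hw, one_mul]
    _ = w * (x * σ w) := by ring
    _ = w := by rw [h2, mul_one]

omit [DecidableEq ι] [GradedRing 𝒜] in
/-- Units of the invariant subring are detected in `B`. [folklore] -/
theorem isUnit_iff_coe_isUnit_invariantSubring (x : invariantSubring σ) :
    IsUnit x ↔ IsUnit (x : B) := by
  refine ⟨fun h => h.map (invariantSubring σ).subtype, fun h => ?_⟩
  obtain ⟨w, hw⟩ := isUnit_iff_exists_inv.1 h
  have hwσ : σ w = w := map_eq_self_of_mul_eq_one σ ((mem_invariantSubring_iff σ _).1 x.2) hw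
  exact isUnit_iff_exists_inv.2 ⟨⟨w, (mem_invariantSubring_iff σ w).2 hwσ⟩, Subtype.ext hw⟩

/-- Units of the degree-`0` invariant subring are detected in `B` (the inverse of a degree-`0`
invariant unit is its degree-`0` component, again invariant). [OURS · L1 W4.5c] -/
theorem isUnit_iff_coe_isUnit_degZeroInvariants (hσ : ∀ c : ι, ∀ b ∈ 𝒜 c, σ b ∈ 𝒜 c)
    (x : degZeroInvariants 𝒜 σ) : IsUnit x ↔ IsUnit (x : B) := by
  refine ⟨fun h => h.map (degZeroInvariants 𝒜 σ).subtype, fun h => ?_⟩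
  obtain ⟨w, hw⟩ := isUnit_iff_exists_inv.1 h
  have hx0 : (x : B) ∈ 𝒜 0 := x.2.1
  have hxσ : σ (x : B) = x := x.2.2
  have hwσ : w ∈ invariantSubring σ :=
    (mem_invariantSubring_iff σ w).2 (map_eq_self_of_mul_eq_one σ hxσ hw)
  have hw₀ : (x : B) * (decompose 𝒜 w 0 : B) = 1 := by
    have h1 := coe_decompose_mul_of_left_mem_zero 𝒜 (j := (0 : ι)) (b := w) hx0
    rw [hw, decompose_of_mem_same 𝒜 (SetLike.GradedOne.one_mem (A := 𝒜))] at h1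
    exact h1.symm
  refine isUnit_iff_exists_inv.2 ⟨⟨(decompose 𝒜 w 0 : B), (decompose 𝒜 w 0).2, ?_⟩, Subtype.ext hw₀⟩
  exact (mem_invariantSubring_iff σ _).1 (coe_decompose_mem_invariantSubring 𝒜 σ hσ hwσ 0)

/-- The degree-`0` invariant subring of a LOCAL graded ring is local. [OURS · L1 W4.5c] -/
theorem isLocalRing_degZeroInvariants [IsLocalRing B] (hσ : ∀ c : ι, ∀ b ∈ 𝒜 c, σ b ∈ 𝒜 c) :
    IsLocalRing (degZeroInvariants 𝒜 σ) := by
  refine IsLocalRing.of_nonunits_add ?_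
  intro a b ha hb
  rw [mem_nonunits_iff, isUnit_iff_coe_isUnit_degZeroInvariants 𝒜 σ hσ] at ha hb ⊢
  rw [Subring.coe_add]
  exact IsLocalRing.nonunits_add ha hb

omit [DecidableEq ι] [GradedRing 𝒜] in
/-- The invariant subring of a LOCAL ring is local. [folklore] -/
theorem isLocalRing_invariantSubring [IsLocalRing B] : IsLocalRing (invariantSubring σ) := by
  refine IsLocalRing.of_nonunits_add ?_
  intro a b ha hb
  rw [mem_nonunits_iff, isUnit_iff_coe_isUnit_invariantSubring σ] at ha hb ⊢
  rw [Subring.coe_add]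
  exact IsLocalRing.nonunits_add ha hb

omit [DecidableEq ι] [GradedRing 𝒜] in
/-- For a local `B` with local invariant subring, an invariant lies in `𝔪_{B^σ}` iff it lies in `𝔪_B`
(units of `B^σ` are the invariant units of `B`). [folklore] -/
theorem mem_maximalIdeal_invariantSubring_iff [IsLocalRing B] [IsLocalRing (invariantSubring σ)]
    (x : invariantSubring σ) :
    x ∈ IsLocalRing.maximalIdeal (invariantSubring σ) ↔ (x : B) ∈ IsLocalRing.maximalIdeal B := by
  rw [IsLocalRing.mem_maximalIdeal, IsLocalRing.mem_maximalIdeal, mem_nonunits_iff, mem_nonunits_iff,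
    isUnit_iff_coe_isUnit_invariantSubring σ]

/-- For a local `B` and a graded `σ`, a degree-zero invariant lies in the maximal ideal of `degZeroInvariants 𝒜 σ`
iff it lies in `𝔪_B`. [folklore] -/
theorem mem_maximalIdeal_degZeroInvariants_iff [IsLocalRing B] [IsLocalRing (degZeroInvariants 𝒜 σ)]
    (hσ : ∀ c : ι, ∀ b ∈ 𝒜 c, σ b ∈ 𝒜 c) (x : degZeroInvariants 𝒜 σ) :
    x ∈ IsLocalRing.maximalIdeal (degZeroInvariants 𝒜 σ) ↔ (x : B) ∈ IsLocalRing.maximalIdeal B := by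
  rw [IsLocalRing.mem_maximalIdeal, IsLocalRing.mem_maximalIdeal, mem_nonunits_iff, mem_nonunits_iff,
    isUnit_iff_coe_isUnit_degZeroInvariants 𝒜 σ hσ]

/-- **(R-triv) ⇒ (H-hom).** If every homogeneous element of non-zero degree is a non-unit, then
every homogeneous component of an element of `𝔪_B` lies in `𝔪_B`. [OURS · L1 W4.5c] -/
theorem coe_decompose_mem_maximalIdeal [IsLocalRing B]
    (hR : ∀ c : ι, c ≠ 0 → ∀ b ∈ 𝒜 c, b ∈ IsLocalRing.maximalIdeal B) {b : B}
    (hb : b ∈ IsLocalRing.maximalIdeal B) (c : ι) :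
    ((decompose 𝒜 b) c : B) ∈ IsLocalRing.maximalIdeal B := by
  classical
  by_cases hc : c = 0
  · subst hc
    by_cases h0 : (0 : ι) ∈ (decompose 𝒜 b).support
    · have hsum := Finset.add_sum_erase _ (fun i => (decompose 𝒜 b i : B)) h0
      rw [sum_support_decompose] at hsum
      rw [eq_sub_of_add_eq hsum]
      refine Ideal.sub_mem _ hb (Ideal.sum_mem _ fun i hi => ?_)
      exact hR i (Finset.ne_of_mem_erase hi) _ (decompose 𝒜 b i).2
    · have h00 : decompose 𝒜 b 0 = 0 := by simpa [DFinsupp.mem_support_iff] using h0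
      simp [h00]
  · exact hR c hc _ (decompose 𝒜 b c).2

end GradedInvariants

end Summit.ResolutionOfSingularities.ResolutionOfSingularities.Theorems.WildQuotientResolution.S1.LogExitFrames
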